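import Mathlib
import HarnessLib
import Literature.Analysis.FluidPDE.SuitableWeak
import Literature.Analysis.FluidPDE.LocalTypeI
import Literature.Analysis.FluidPDE.LocalTypeIScaling
import Literature.Analysis.FluidPDE.ESSLocalHolderBlowupTop
import Summits.NavierStokesRegularity.NavierStokesRegularity.Theorems.RellichScarNoMildScarZoom
import Summits.NavierStokesRegularity.NavierStokesRegularity.Theorems.RellichScarNoMildScarGauge

/-!
# No mild scar under Type I (route RellichScar, item `NoMildScar`): pairings of the zooms near the top

Helper file for the proof of `Summit.NavierStokesRegularity.NavierStokesRegularity.Theses.RellichScar.NoMildScar`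
(stmt-NavierStokesRegularity-11723).  Two inputs of the weak top-vanishing of the blow-up limit
(`RellichScarNoMildScarTop`), in the spirit of ESS 2003, §3 (3.13) / Seregin 2014, (6.6.2)–(6.6.3),
where the `L³` trace of an `L_{3,∞}` solution at the final time plays the role of the scar:

* `exists_uniform_pairing_modulus_apexZoom` — the pairings `s ↦ ∫ ⟪u_c(s), φ⟫` of the zooms
  `u_c(s, y) = c u(c² s, c y)` of a slab profile with `𝐈 < ∞` against a test field `φ` share ONE
  modulus of continuity `A|s − s'| + B|s − s'|^{1/3}` for all scales `c > 0` (the tree's weak time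
  equicontinuity `NSCylinder.exists_fullMeasure_pairing_modulus`; its constants see the solution
  only through the sliced `L²` bound `A(Q(0,ρ)) ≤ 𝐈` and the `L^{3/2}(Q(0,ρ))` bound `ρ² 𝐈` of the
  pressure in the local gauge `p − [p]_{B(0,ρ)}(t)`, both scale invariant);
* `ae_pairing_sub_scar_le` — if a field `U` has the scar `sg` off the origin
  (`esssup_{(−δ,0)×K} |U − sg| → 0` for compact `K ∌ 0`), sliced bounds `∫_{B_η} |U(s)|² ≤ η I`
  and `sg ∈ L¹(B_ρ)`, then `∫ ⟪U(s), φ⟫ → ∫ ⟪sg, φ⟫` as `s ↑ 0` essentially: the origin is cut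
  out by a small ball, on which both fields are small in `L¹`.

References: Escauriaza–Seregin–Šverák 2003, §3; Seregin 2014, §6.6; Temam 1977/79, Ch. III §3
(weak time continuity of the pairings); Albritton–Barker 2019, §1 (`A`, `D`, `𝐈`).
-/

noncomputable section

-- the summit and its single sub-problem share the name (CONVENTIONS §1), as in every Theorems file
set_option linter.dupNamespace false

namespace Summit.NavierStokesRegularity.NavierStokesRegularity.Theorems.RellichScarNoMildScar

open MeasureTheory Set Function Metric Filter Topology TopologicalSpace
open scoped ENNReal NNReal InnerProductSpace RealInnerProductSpace
open Literature.Analysis Literature.Analysis.FluidPDE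

local notation "E³" => EuclideanSpace ℝ (Fin 3)

variable {u : ℝ → E³ → E³} {p : ℝ → E³ → ℝ} {G : ℝ → E³ → E³ →L[ℝ] E³}

/-! ### Sliced `L²` bounds from `A ≤ 𝐈` -/

/-- **Sliced `L²` bounds on balls hanging from the final time**: `A(Q(0, η)) ≤ 𝐈` gives
`∫_{B(0,η)} |U(s)|² ≤ η 𝐈` for a.e. `s ∈ (−η², 0)`. [cite: AlbrittonBarker2019, §1] -/
theorem ae_lintegral_ball_sq_le {U : ℝ → E³ → E³} {P : ℝ → E³ → ℝ}
    {G' : ℝ → E³ → E³ →L[ℝ] E³} {I : ℝ≥0∞}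
    (hbd : typeIBound (Iio (0 : ℝ) ×ˢ (univ : Set E³)) U P G' ≤ I) {η : ℝ} (hη : 0 < η) :
    ∀ᵐ s ∂(volume.restrict (Ioo (-η ^ 2) 0)),
      ∫⁻ y in ball (0 : E³) η, ‖U s y‖ₑ ^ 2 ≤ ENNReal.ofReal η * I := by
  have hA : cknAEss η (0 : ℝ × E³) U ≤ I :=
    (cknAEss_le_abScaledSum (p := P) (G := G')).trans
      ((abScaledSum_le_typeIBound hη (parabolicCylinder_subset_lowerHalf le_rfl η)).trans hbd)
  unfold cknAEss at hA
  have hη0 : ENNReal.ofReal η ≠ 0 := (ENNReal.ofReal_pos.2 hη).ne'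
  have e : Ioo ((0 : ℝ × E³).1 - η ^ 2) ((0 : ℝ × E³).1) = Ioo (-η ^ 2) 0 := by simp
  rw [e] at hA
  filter_upwards [ENNReal.ae_le_essSup fun t : ℝ =>
    (ENNReal.ofReal η)⁻¹ * ∫⁻ x in ball (0 : ℝ × E³).2 η, ‖U t x‖ₑ ^ 2] with t ht
  exact (ENNReal.inv_mul_le_iff hη0 ENNReal.ofReal_ne_top).1 (ht.trans hA)

/-! ### A modulus of continuity of the pairings of the zooms, uniform in the scale -/

/-- **Uniform weak time-equicontinuity of the zooms of a slab profile.**  Let `(u, p)` be a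
suitable weak solution on the backward slab with weak gradient `G` and `𝐈 < ∞`, and let `φ` be a
test field with `tsupport φ ⊆ B(0, ρ)`, `ρ ≥ 1`.  There are `A, B ≥ 0` such that for EVERY scale
`c > 0` the pairing `s ↦ ∫ ⟪u_c(s), φ⟫` of the zoom `u_c(s, y) = c u(c² s, c y)` satisfies
`|∫ ⟪u_c(s), φ⟫ − ∫ ⟪u_c(s'), φ⟫| ≤ A |s − s'| + B |s − s'|^{1/3}` for all `s, s'` in a full-measure
subset of `(−ρ², 0)` (Temam 1977/79, Ch. III §3 through the tree's
`NSCylinder.exists_fullMeasure_pairing_modulus`, applied to `(u_c, p_c − [p_c]_{B(0,ρ)})` on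
`Q(0, ρ)` with the scale-invariant bounds `A(Q(0,ρ)) ≤ 𝐈`, `∫_{Q(0,ρ)} |p_c − [p_c]|^{3/2} ≤ ρ² 𝐈`).
[cite: EscauriazaSereginSverak2003, §3 (3.13)] -/
theorem exists_uniform_pairing_modulus_apexZoom
    (hsw : IsSuitableWeakSolutionOn (slab E³ (Iio 0) isOpen_Iio) 1 0 u p)
    (hI : typeIBound (Iio (0 : ℝ) ×ˢ univ) u p G < ⊤)
    {φ : E³ → E³} (hφ : ContDiff ℝ (⊤ : ℕ∞) φ) (hφc : HasCompactSupport φ) {ρ : ℝ} (hρ1 : 1 ≤ ρ)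
    (hφρ : tsupport φ ⊆ ball (0 : E³) ρ) :
    ∃ A B : ℝ, 0 ≤ A ∧ 0 ≤ B ∧ ∀ c : ℝ, 0 < c →
      ∃ S : Set ℝ, (∀ᵐ s ∂(volume.restrict (Ioo (-ρ ^ 2) 0)), s ∈ S) ∧ ∀ s ∈ S, ∀ s' ∈ S,
        |(∫ y, ⟪(c • stPull (c ^ 2) c 0 (0 : E³) u) s y, φ y⟫) -
            ∫ y, ⟪(c • stPull (c ^ 2) c 0 (0 : E³) u) s' y, φ y⟫| ≤
          A * |s - s'| + B * |s - s'| ^ (1 / 3 : ℝ) := by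
  have hρ : 0 < ρ := one_pos.trans_le hρ1
  set I : ℝ≥0∞ := typeIBound (Iio (0 : ℝ) ×ˢ (univ : Set E³)) u p G with hIdef
  have hItop : I ≠ ⊤ := hI.ne
  set Ω : Opens E³ := ⟨ball 0 ρ, isOpen_ball⟩ with hΩdef
  have hΩset : ((Ω : Opens E³) : Set E³) = ball 0 ρ := rfl
  have hbΩ : Bornology.IsBounded ((Ω : Opens E³) : Set E³) := by rw [hΩset]; exact isBounded_ball
  have hηt : FunctionSpaces.IsTestFunctionOn Ω φ := ⟨hφ, hφc, hφρ⟩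
  obtain ⟨K₀, K₁, K₂, hK₀, hK₁, hK₂⟩ := exists_bounds_of_isTestFunctionOn hηt
  -- ## the uniform constants
  set Cs : ℝ≥0∞ := ENNReal.ofReal ρ * I with hCs
  have hCstop : Cs ≠ ⊤ := ENNReal.mul_ne_top ENNReal.ofReal_ne_top hItop
  set Cp : ℝ≥0∞ := ENNReal.ofReal ρ ^ 2 * I with hCp
  have hCptop : Cp ≠ ⊤ := ENNReal.mul_ne_top (ENNReal.pow_ne_top ENNReal.ofReal_ne_top) hItop
  set A : ℝ := K₁ * Cs.toReal + K₂ * ((volume ((Ω : Opens E³) : Set E³)).toReal + Cs.toReal) with hA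
  set B : ℝ := 3 * K₁ * (((volume ((Ω : Opens E³) : Set E³)) ^ (1 / 2 : ℝ) * Cp) ^ (2 / 3 : ℝ)).toReal
    with hB
  have hK₁0 : 0 ≤ K₁ := (norm_nonneg _).trans (hK₁ 0)
  have hK₂0 : 0 ≤ K₂ := (norm_nonneg _).trans (hK₂ 0)
  refine ⟨A, B, by positivity, by positivity, fun c hc => ?_⟩
  -- ## the zoom at scale `c`, in the local gauge on `B(0, ρ)`
  set a : ℝ := (0 : ℝ × E³).1 - ρ ^ 2 with ha
  set b : ℝ := (0 : ℝ × E³).1 with hb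
  have hab' : Ioo a b = Ioo (-ρ ^ 2) 0 := by
    rw [ha, hb]; show Ioo ((0 : ℝ) - ρ ^ 2) 0 = Ioo (-ρ ^ 2) 0; rw [zero_sub]
  have hcyl : timeCylinder Ω a b = parabolicCylinderOpens ρ (0 : ℝ × E³) := rfl
  have hcyl_set : Ioo a b ×ˢ ((Ω : Opens E³) : Set E³) = parabolicCylinder ρ (0 : ℝ × E³) := rfl
  set U : ℝ → E³ → E³ := c • stPull (c ^ 2) c 0 (0 : E³) u with hU
  set Pc : ℝ → E³ → ℝ := c ^ 2 • stPull (c ^ 2) c 0 (0 : E³) p with hPc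
  set Gc : ℝ → E³ → E³ →L[ℝ] E³ := c ^ 2 • stPull (c ^ 2) c 0 (0 : E³) G with hGc
  have hswc : IsSuitableWeakSolutionOn (slab E³ (Iio 0) isOpen_Iio) 1 0 U Pc :=
    zoom_isSuitableWeakSolutionOn_slab hsw hc
  have hbdc : typeIBound (Iio (0 : ℝ) ×ˢ (univ : Set E³)) U Pc Gc ≤ I :=
    (typeIBound_lowerHalf_nsZoom hc u p G).le
  set Pg : ℝ → E³ → ℝ := fun t x => Pc t x - ⨍ y in ball (0 : E³) ρ, Pc t y with hPg
  have hswg : IsSuitableWeakSolutionOn (slab E³ (Iio 0) isOpen_Iio) 1 0 U Pg :=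
    sub_ballMean_slab hswc 0 hρ
  have hle : parabolicCylinderOpens ρ (0 : ℝ × E³) ≤ (slab E³ (Iio (0 : ℝ)) isOpen_Iio) :=
    parabolicCylinderOpens_le_slab ρ le_rfl
  have hsol : IsDistributionalNSSolutionOn (timeCylinder Ω a b) 1 0 U Pg := by
    rw [hcyl]; exact (hswg.of_le hle).distributional
  -- the sliced `L²` bound, uniformly in `c`
  have hE : ∀ᵐ t ∂(volume.restrict (Ioo a b)),
      ∫⁻ x in ((Ω : Opens E³) : Set E³), ‖U t x‖ₑ ^ 2 ≤ Cs := by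
    rw [hab', hΩset]
    exact ae_lintegral_ball_sq_le hbdc hρ
  -- the pressure bound, uniformly in `c`
  have hP : ∫⁻ z in Ioo a b ×ˢ ((Ω : Opens E³) : Set E³), ‖Pg z.1 z.2‖ₑ ^ (3 / 2 : ℝ) ≤ Cp := by
    rw [hcyl_set]
    exact (lintegral_sub_ballMean_le_typeIBound hρ (z := (0 : ℝ × E³)) le_rfl U Pc Gc).trans
      (mul_le_mul' le_rfl hbdc)
  -- ## the modulus
  obtain ⟨S, hS, hmod⟩ := NSCylinder.exists_fullMeasure_pairing_modulus hsol hbΩ hCstop hCptop hE hP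
    hηt hK₁ hK₂
  refine ⟨S, by rw [← hab']; exact hS, fun s hs s' hs' => ?_⟩
  have h1 := hmod s hs s' hs'
  rw [hΩset, ← integral_inner_eq_setIntegral_of_tsupport hφρ,
    ← integral_inner_eq_setIntegral_of_tsupport hφρ] at h1
  exact h1

/-! ### The pairings tend to the pairing of the scar -/

/-- **The pairings tend to the pairing of the scar, essentially, as `s ↑ 0`.**  Let `U` be a field
on the slab with the sliced bounds `∫_{B(0,η)} |U(s)|² ≤ η I` (a.e. `s ∈ (−η², 0)`, all `η > 0`),
with slices integrable on `B(0, ρ)` for a.e. `s ∈ (−ρ², 0)`, `ρ ≥ 1`, and with the SCAR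
`sg ∈ L¹(B(0, ρ))` off the origin: `esssup_{(−δ,0)×K} |U − sg| → 0` as `δ ↓ 0` for every compact
`K ∌ 0`.  Then for every continuous `φ` with `|φ| ≤ K₀` supported in `B(0, ρ)` and every `ε > 0`
there is `τ > 0` with `|∫ ⟪U(s), φ⟫ − ∫ ⟪sg, φ⟫| ≤ ε` for a.e. `s ∈ (−τ, 0)`: cut out a small ball
`B(0, η)` around the origin, on which `∫ |U(s)| ≤ |B_η| + η I` and `∫ |sg|` are small, and use the
scar on the compact ring `B̄(0, ρ) ∖ B(0, η)`. [folklore] -/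
theorem ae_pairing_sub_scar_le
    {U : ℝ → E³ → E³} {sg : E³ → E³} {I : ℝ≥0∞} (hItop : I ≠ ⊤) {ρ : ℝ} (hρ1 : 1 ≤ ρ)
    (hA : ∀ η : ℝ, 0 < η → ∀ᵐ s ∂(volume.restrict (Ioo (-η ^ 2) 0)),
      ∫⁻ y in ball (0 : E³) η, ‖U s y‖ₑ ^ 2 ≤ ENNReal.ofReal η * I)
    (hUint : ∀ᵐ s ∂(volume.restrict (Ioo (-ρ ^ 2) 0)), IntegrableOn (U s) (ball (0 : E³) ρ) volume)
    (hsgm : AEStronglyMeasurable sg (volume.restrict (ball (0 : E³) ρ)))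
    (hsg1 : ∫⁻ y in ball (0 : E³) ρ, ‖sg y‖ₑ < ⊤)
    (hsc : ∀ K : Set E³, IsCompact K → (0 : E³) ∉ K →
      Tendsto (fun δ : ℝ => eLpNorm (fun z : ℝ × E³ => U z.1 z.2 - sg z.2) ⊤
        (volume.restrict (Ioo (-δ) 0 ×ˢ K))) (𝓝[>] 0) (𝓝 0))
    {φ : E³ → E³} (hφc : Continuous φ) {K₀ : ℝ} (hK₀ : ∀ x, ‖φ x‖ ≤ K₀)
    (hφρ : tsupport φ ⊆ ball (0 : E³) ρ) {ε : ℝ} (hε : 0 < ε) :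
    ∃ τ : ℝ, 0 < τ ∧ ∀ᵐ s ∂(volume.restrict (Ioo (-τ) 0)),
      |(∫ y, ⟪U s y, φ y⟫) - ∫ y, ⟪sg y, φ y⟫| ≤ ε := by
  have hρ : 0 < ρ := one_pos.trans_le hρ1
  have hK₀0 : 0 ≤ K₀ := (norm_nonneg _).trans (hK₀ 0)
  set Bρ : Set E³ := ball (0 : E³) ρ with hBρ
  -- ## the two small terms near the origin, as functions of the cut-off radius `η`
  set f : E³ → ℝ≥0∞ := Bρ.indicator fun y => ‖sg y‖ₑ with hf
  have hf_fin : ∫⁻ y, f y ≠ ⊤ := by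
    rw [hf, lintegral_indicator measurableSet_ball]; exact hsg1.ne
  have hvol0 : Tendsto (fun η : ℝ => volume (ball (0 : E³) η)) (𝓝[>] 0) (𝓝 0) := by
    have h1 : Tendsto (fun η : ℝ => ENNReal.ofReal (η ^ 3) * volume (ball (0 : E³) 1))
        (𝓝[>] 0) (𝓝 0) := by
      have h2 : Tendsto (fun η : ℝ => η ^ 3) (𝓝 (0 : ℝ)) (𝓝 0) := by
        have := (continuous_pow 3).tendsto (0 : ℝ); rwa [zero_pow three_ne_zero] at this
      have h3 : Tendsto (fun η : ℝ => ENNReal.ofReal (η ^ 3)) (𝓝 (0 : ℝ)) (𝓝 0) := by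
        have := ENNReal.tendsto_ofReal h2; rwa [ENNReal.ofReal_zero] at this
      have h4 := ENNReal.Tendsto.mul_const h3
        (Or.inr (measure_ball_lt_top (μ := (volume : Measure E³)) (x := 0) (r := 1)).ne)
      rw [zero_mul] at h4
      exact h4.mono_left nhdsWithin_le_nhds
    refine (tendsto_congr' ?_).1 h1
    filter_upwards [self_mem_nhdsWithin] with η hη
    rw [Measure.addHaar_ball_of_pos (volume : Measure E³) _ hη, finrank_euclideanSpace_fin]
  have hg : Tendsto (fun η : ℝ => ∫⁻ y in ball (0 : E³) η, f y) (𝓝[>] 0) (𝓝 0) :=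
    tendsto_setLIntegral_zero hf_fin hvol0
  have hb₁ : Tendsto (fun η : ℝ => volume (ball (0 : E³) η) + ENNReal.ofReal η * I)
      (𝓝[>] 0) (𝓝 0) := by
    have h1 : Tendsto (fun η : ℝ => ENNReal.ofReal η * I) (𝓝[>] 0) (𝓝 0) := by
      have h2 : Tendsto (fun η : ℝ => ENNReal.ofReal η) (𝓝 (0 : ℝ)) (𝓝 0) := by
        have := ENNReal.tendsto_ofReal (tendsto_id (x := 𝓝 (0 : ℝ)))
        rwa [ENNReal.ofReal_zero] at this
      have h3 := ENNReal.Tendsto.mul_const h2 (Or.inr hItop)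
      rw [zero_mul] at h3
      exact h3.mono_left nhdsWithin_le_nhds
    simpa using hvol0.add h1
  -- ## the choice of `η`
  set e₁ : ℝ≥0∞ := ENNReal.ofReal (ε / (2 * (K₀ + 1))) with he₁
  have he₁pos : 0 < e₁ := ENNReal.ofReal_pos.2 (by positivity)
  have hev : ∀ᶠ η in 𝓝[>] (0 : ℝ), (volume (ball (0 : E³) η) + ENNReal.ofReal η * I) +
      ∫⁻ y in ball (0 : E³) η, f y ≤ e₁ := by
    have := hb₁.add hg
    rw [add_zero] at this
    exact this (Iic_mem_nhds he₁pos)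
  have hev' : ∀ᶠ η in 𝓝[>] (0 : ℝ), η < 1 :=
    mem_nhdsWithin_of_mem_nhds (Iio_mem_nhds one_pos)
  obtain ⟨η, hηpos, hηsmall, hη1⟩ := ((eventually_mem_nhdsWithin : ∀ᶠ x in 𝓝[>] (0 : ℝ), x ∈ Ioi 0).and
    (hev.and hev')).exists
  have hηpos : 0 < η := hηpos
  have hηρ : η < ρ := hη1.trans_le hρ1
  have hBηρ : ball (0 : E³) η ⊆ Bρ := ball_subset_ball hηρ.le
  -- ## the compact ring and the scar on it
  set K : Set E³ := closedBall (0 : E³) ρ \ ball 0 η with hKdef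
  have hKc : IsCompact K := (isCompact_closedBall _ _).diff isOpen_ball
  have h0K : (0 : E³) ∉ K := fun h => h.2 (mem_ball_self hηpos)
  have hKm : MeasurableSet K := measurableSet_closedBall.diff measurableSet_ball
  have hvolK : volume K ≠ ⊤ :=
    ((measure_mono fun x (hx : x ∈ K) => hx.1).trans_lt
      (isCompact_closedBall (0 : E³) ρ).measure_lt_top).ne
  set e₃ : ℝ≥0∞ := ENNReal.ofReal (ε / (2 * (K₀ + 1) * ((volume K).toReal + 1))) with he₃
  have he₃pos : 0 < e₃ := ENNReal.ofReal_pos.2 (by positivity)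
  have hevδ : ∀ᶠ δ in 𝓝[>] (0 : ℝ), eLpNorm (fun z : ℝ × E³ => U z.1 z.2 - sg z.2) ⊤
      (volume.restrict (Ioo (-δ) 0 ×ˢ K)) ≤ e₃ := (hsc K hKc h0K) (Iic_mem_nhds he₃pos)
  obtain ⟨δ, hδpos, hδsmall⟩ := ((eventually_mem_nhdsWithin : ∀ᶠ x in 𝓝[>] (0 : ℝ), x ∈ Ioi 0).and hevδ).exists
  have hδpos : 0 < δ := hδpos
  -- Fubini: for a.e. `s ∈ (−δ, 0)`, `|U(s) − sg| ≤ e₃` a.e. on `K`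
  have hscar_ae : ∀ᵐ s ∂(volume.restrict (Ioo (-δ) 0)), ∀ᵐ y ∂(volume.restrict K),
      ‖U s y - sg y‖ₑ ≤ e₃ := by
    have h1 : ∀ᵐ z ∂(volume.restrict (Ioo (-δ) 0 ×ˢ K)), ‖U z.1 z.2 - sg z.2‖ₑ ≤ e₃ := by
      filter_upwards [enorm_ae_le_eLpNormEssSup (fun z : ℝ × E³ => U z.1 z.2 - sg z.2)
        (volume.restrict (Ioo (-δ) 0 ×ˢ K))] with z hz
      rw [← eLpNorm_exponent_top] at hz
      exact hz.trans hδsmall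
    rw [volume_restrict_prod_eq] at h1
    exact Measure.ae_ae_of_ae_prod h1
  -- ## the choice of `τ`
  set τ : ℝ := min δ (η ^ 2) with hτ
  have hτpos : 0 < τ := lt_min hδpos (by positivity)
  have hτδ : Ioo (-τ) 0 ⊆ Ioo (-δ) 0 := Ioo_subset_Ioo (neg_le_neg (min_le_left _ _)) le_rfl
  have hτη : Ioo (-τ) 0 ⊆ Ioo (-η ^ 2) 0 := Ioo_subset_Ioo (neg_le_neg (min_le_right _ _)) le_rfl
  have hτρ : Ioo (-τ) 0 ⊆ Ioo (-ρ ^ 2) 0 := by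
    refine hτη.trans (Ioo_subset_Ioo (neg_le_neg ?_) le_rfl)
    exact pow_le_pow_left₀ hηpos.le hηρ.le 2
  refine ⟨τ, hτpos, ?_⟩
  filter_upwards [ae_restrict_of_ae_restrict_of_subset hτδ hscar_ae,
    ae_restrict_of_ae_restrict_of_subset hτη (hA η hηpos),
    ae_restrict_of_ae_restrict_of_subset hτρ hUint] with s hsK hsA hsU
  -- ## the estimate at a good time `s`
  -- integrability of the two pairings on `B(0, ρ)`
  have hφm : AEStronglyMeasurable φ (volume.restrict Bρ) := hφc.aestronglyMeasurable
  have hinner_int : ∀ {g : E³ → E³}, Integrable g (volume.restrict Bρ) →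
      Integrable (fun y => ⟪g y, φ y⟫) (volume.restrict Bρ) := by
    intro g hg
    refine Integrable.mono' (hg.norm.mul_const K₀) (hg.1.inner hφm) (Eventually.of_forall fun y => ?_)
    calc ‖⟪g y, φ y⟫‖ ≤ ‖g y‖ * ‖φ y‖ := norm_inner_le_norm _ _
      _ ≤ ‖g y‖ * K₀ := mul_le_mul_of_nonneg_left (hK₀ _) (norm_nonneg _)
  have hsgint : Integrable sg (volume.restrict Bρ) := ⟨hsgm, hsg1⟩
  have hUs : Integrable (U s) (volume.restrict Bρ) := hsU
  have hdiff : (∫ y, ⟪U s y, φ y⟫) - ∫ y, ⟪sg y, φ y⟫ = ∫ y in Bρ, ⟪U s y - sg y, φ y⟫ := by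
    rw [integral_inner_eq_setIntegral_of_tsupport hφρ, integral_inner_eq_setIntegral_of_tsupport hφρ,
      ← integral_sub (hinner_int hUs) (hinner_int hsgint)]
    refine integral_congr_ae (Eventually.of_forall fun y => ?_)
    show ⟪U s y, φ y⟫ - ⟪sg y, φ y⟫ = ⟪U s y - sg y, φ y⟫
    rw [inner_sub_left]
  -- the pointwise bound of the integrand and the splitting `B_ρ ⊆ B_η ∪ K`
  have hsplit : Bρ ⊆ ball (0 : E³) η ∪ K := by
    intro y hy
    by_cases hyη : y ∈ ball (0 : E³) η
    · exact Or.inl hyη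
    · exact Or.inr ⟨ball_subset_closedBall hy, hyη⟩
  have hUm : AEMeasurable (fun y => ‖U s y‖ₑ) (volume.restrict (ball (0 : E³) η)) :=
    (hUs.1.mono_measure (Measure.restrict_mono hBηρ le_rfl)).enorm
  have hsgm' : AEMeasurable (fun y => ‖sg y‖ₑ) (volume.restrict (ball (0 : E³) η)) :=
    (hsgm.mono_measure (Measure.restrict_mono hBηρ le_rfl)).enorm
  -- `∫_{B_η} |U(s) − sg| ≤ (|B_η| + η I) + ∫_{B_η} |sg|`
  have hnear : ∫⁻ y in ball (0 : E³) η, ‖U s y - sg y‖ₑ ≤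
      (volume (ball (0 : E³) η) + ENNReal.ofReal η * I) + ∫⁻ y in ball (0 : E³) η, f y := by
    have hfg : ∫⁻ y in ball (0 : E³) η, ‖sg y‖ₑ = ∫⁻ y in ball (0 : E³) η, f y := by
      refine setLIntegral_congr_fun measurableSet_ball fun y hy => ?_
      rw [hf, indicator_of_mem (hBηρ hy)]
    calc ∫⁻ y in ball (0 : E³) η, ‖U s y - sg y‖ₑ
        ≤ ∫⁻ y in ball (0 : E³) η, (‖U s y‖ₑ + ‖sg y‖ₑ) := lintegral_mono fun y => enorm_sub_le
      _ = (∫⁻ y in ball (0 : E³) η, ‖U s y‖ₑ) + ∫⁻ y in ball (0 : E³) η, ‖sg y‖ₑ :=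
          lintegral_add_left' hUm _
      _ ≤ (∫⁻ y in ball (0 : E³) η, (1 + ‖U s y‖ₑ ^ 2)) + ∫⁻ y in ball (0 : E³) η, ‖sg y‖ₑ := by
          gcongr with y
          exact ENNReal.le_one_add_sq _
      _ = (volume (ball (0 : E³) η) + ∫⁻ y in ball (0 : E³) η, ‖U s y‖ₑ ^ 2) +
            ∫⁻ y in ball (0 : E³) η, ‖sg y‖ₑ := by
          rw [lintegral_add_left measurable_const, lintegral_const, Measure.restrict_apply_univ, one_mul]
      _ ≤ (volume (ball (0 : E³) η) + ENNReal.ofReal η * I) + ∫⁻ y in ball (0 : E³) η, f y := by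
          rw [hfg]; gcongr
  -- `∫_K |U(s) − sg| ≤ e₃ |K|`
  have hfar : ∫⁻ y in K, ‖U s y - sg y‖ₑ ≤ e₃ * volume K := by
    calc ∫⁻ y in K, ‖U s y - sg y‖ₑ ≤ ∫⁻ _ in K, e₃ := lintegral_mono_ae hsK
      _ = e₃ * volume K := by rw [lintegral_const, Measure.restrict_apply_univ]
  -- assembling
  have hK₀e : ∀ y, ‖⟪U s y - sg y, φ y⟫‖ₑ ≤ ENNReal.ofReal K₀ * ‖U s y - sg y‖ₑ := by
    intro y
    rw [← ofReal_norm, ← ofReal_norm, ← ENNReal.ofReal_mul hK₀0]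
    refine ENNReal.ofReal_le_ofReal ?_
    calc ‖⟪U s y - sg y, φ y⟫‖ ≤ ‖U s y - sg y‖ * ‖φ y‖ := norm_inner_le_norm _ _
      _ ≤ ‖U s y - sg y‖ * K₀ := mul_le_mul_of_nonneg_left (hK₀ _) (norm_nonneg _)
      _ = K₀ * ‖U s y - sg y‖ := mul_comm _ _
  set X : ℝ≥0∞ := ENNReal.ofReal K₀ * (e₁ + e₃ * volume K) with hX
  have hXtop : X ≠ ⊤ := ENNReal.mul_ne_top ENNReal.ofReal_ne_top
    (ENNReal.add_ne_top.2 ⟨ENNReal.ofReal_ne_top, ENNReal.mul_ne_top ENNReal.ofReal_ne_top hvolK⟩)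
  have hbound : ‖∫ y in Bρ, ⟪U s y - sg y, φ y⟫‖ₑ ≤ X := by
    refine (enorm_integral_le_lintegral_enorm _).trans ?_
    calc ∫⁻ y in Bρ, ‖⟪U s y - sg y, φ y⟫‖ₑ
        ≤ ∫⁻ y in Bρ, ENNReal.ofReal K₀ * ‖U s y - sg y‖ₑ := lintegral_mono fun y => hK₀e y
      _ = ENNReal.ofReal K₀ * ∫⁻ y in Bρ, ‖U s y - sg y‖ₑ :=
          lintegral_const_mul' _ _ ENNReal.ofReal_ne_top
      _ ≤ ENNReal.ofReal K₀ * ((∫⁻ y in ball (0 : E³) η, ‖U s y - sg y‖ₑ) +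
            ∫⁻ y in K, ‖U s y - sg y‖ₑ) := by
          gcongr
          exact (lintegral_mono_set hsplit).trans (lintegral_union_le _ _ _)
      _ ≤ ENNReal.ofReal K₀ * (e₁ + e₃ * volume K) :=
          mul_le_mul' le_rfl (add_le_add (hnear.trans hηsmall) hfar)
  -- ## the real-number bookkeeping `X ≤ ε`
  have hXreal : X.toReal ≤ ε := by
    have hV : 0 ≤ (volume K).toReal := ENNReal.toReal_nonneg
    rw [hX, ENNReal.toReal_mul, ENNReal.toReal_ofReal hK₀0, ENNReal.toReal_add ENNReal.ofReal_ne_top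
      (ENNReal.mul_ne_top ENNReal.ofReal_ne_top hvolK), ENNReal.toReal_mul,
      ENNReal.toReal_ofReal (by positivity), ENNReal.toReal_ofReal (by positivity)]
    have h1 : K₀ * (ε / (2 * (K₀ + 1))) ≤ ε / 2 := by
      rw [mul_div_assoc', div_le_div_iff₀ (by positivity) (by norm_num)]
      nlinarith
    have h2 : K₀ * (ε / (2 * (K₀ + 1) * ((volume K).toReal + 1)) * (volume K).toReal) ≤ ε / 2 := by
      rw [div_mul_eq_mul_div, mul_div_assoc', div_le_div_iff₀ (by positivity) (by norm_num)]
      nlinarith [mul_nonneg hK₀0 hV, mul_nonneg (mul_nonneg hK₀0 hV) hε.le]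
    nlinarith [mul_add K₀ (ε / (2 * (K₀ + 1))) (ε / (2 * (K₀ + 1) * ((volume K).toReal + 1)) * (volume K).toReal)]
  rw [hdiff, ← Real.norm_eq_abs]
  calc ‖∫ y in Bρ, ⟪U s y - sg y, φ y⟫‖ = (‖∫ y in Bρ, ⟪U s y - sg y, φ y⟫‖ₑ).toReal := by
        rw [toReal_enorm]
    _ ≤ X.toReal := ENNReal.toReal_mono hXtop hbound
    _ ≤ ε := hXreal

end Summit.NavierStokesRegularity.NavierStokesRegularity.Theorems.RellichScarNoMildScar

end
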